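import Mathlib.Analysis.Calculus.Deriv.CompMul
import Mathlib.MeasureTheory.Measure.Lebesgue.EqHaar
import Mathlib.MeasureTheory.Measure.Haar.InnerProductSpace
import Literature.Analysis.FluidPDE.AxisymmetricEuler
import Literature.Analysis.FluidPDE.SwirlTransportProofs
import Literature.Analysis.FluidPDE.SelfSimilar
import HarnessLib

/-!
# The flat swirl gauge (de-symmetrised swirl `Γ = r u_θ`)

Literature/Analysis/FluidPDE definition file for the object POSITED by route `FlatSwirlGauge` of
`NavierStokesRegularity` (idea card `clebsch-connection-flat-gauge-swirl`, definition request
`defn-HasFlatSwirlGauge`). It is NOT a published notion: the only part of it in print is its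
exactly-flat model, the swirl `Γ = r u_θ` of an axisymmetric Navier–Stokes flow with its
drift–diffusion law `∂ₜΓ + (u·∇)Γ = ν(Δ − (2/r)∂ᵣ)Γ` (Koch–Nadirashvili–Seregin–Šverák 2009,
eq. (1.8); in the tree `Literature.Analysis.FluidPDE.swirl_transport`, PROVED as
`swirl_transport_holds`), read through the viscous Clebsch-variable transport of Constantin 2001
(diffusive Weber–Clebsch connection) and Sato 2021, §4 (the diffusion operator of a Clebsch
potential). The route's v0 rendering, inlined verbatim as the conclusion of its crux
`FlatGaugeAtSingularity` (item `stmt-NavierStokesRegularity-1252`) and as the hypothesis of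
`CriticalSwirlRegularity` / `FlatGaugeExcludesTypeI`, is packaged here WITHOUT any change of meaning
(`hasFlatSwirlGauge_iff` is `Iff.rfl`), so that the route decls can later be restated over the notion.

## The object

A FLAT SWIRL GAUGE for `u : ℝ → ℝ³ → ℝ³` on the backward cylinder
`Q_ρ(T, x₀) = (T − ρ², T) × B_ρ(x₀)` is data `(α, b, d, C₀, M)`
(`IsFlatSwirlGaugeOn ν u T x₀ ρ C₀ M α b d`) with

* `α ∈ C²(Q)`, `|α| ≤ M` (generalised swirl / Clebsch momentum, dimension of circulation);
* `ω · ∇α = 0` on `Q` (`α` is a first integral of the vorticity `ω = curl u`);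
* where `d > 0`: `|ω| d ≤ C₀ |∇α|` (chart nondegeneracy), `|b| d ≤ C₀` and the FLAT transport law
  `(∂ₜ + u·∇)α = ν(Δα + b·∇α)` (pure axis-type drift ⇒ parabolic maximum principle for `α`);
* `vol({d < δ} ∩ B_ρ(x₀)) ≤ C₀ δ² ρ` for `0 < δ < ρ` (the degeneracy set `{d = 0}` is axis-like).

`HasFlatSwirlGauge ν u T x₀ := ∃ ρ C₀ M α b d, IsFlatSwirlGaugeOn ν u T x₀ ρ C₀ M α b d`.
Existence at a singular point is the route's crux and is NOT asserted anywhere in this file.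

## API (all proved)

* `hasFlatSwirlGauge_iff` (`Iff.rfl` with the inline block of `stmt-NavierStokesRegularity-1252`);
* `IsFlatSwirlGaugeOn.const_nonneg` (`0 ≤ C₀` is forced), `.mono_const` (larger constants),
  `.restrict` (smaller radius `ρ' ≤ ρ` keeps `M` and the pointwise constant; the volume clause
  `vol ≤ C₀δ²ρ` is not monotone in `ρ`, so the packaged constant becomes `C₀ρ/ρ'`),
  `HasFlatSwirlGauge.exists_radius_le`;
* NS-scaling covariance `IsFlatSwirlGaugeOn.nsRescale` / `HasFlatSwirlGauge.nsRescale` /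
  `hasFlatSwirlGauge_nsRescale_iff`: for `u_c(t,x) = c u(c²t, cx)` (`nsRescale`) the data
  `(α(c²t,cx), c b(c²t,cx), c⁻¹ d(c²t,cx))` is a gauge at `(T/c², x₀/c)` of radius `ρ/c` with THE
  SAME constants `C₀, M` (junk-robust dilation calculus `curl_smul_comp_smul`, `gradient_comp_smul`,
  `laplacian_comp_smul_eq`; Haar scaling of `volume`);
* translation covariance in space `IsFlatSwirlGaugeOn.translate` / `HasFlatSwirlGauge.translate` /
  `hasFlatSwirlGauge_translate_iff` (normalise `x₀ = 0`; the time origin is fixed by `ρ² < T`);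
* the exactly-flat ANCHOR: for every axisymmetric field `⟪curl u, ∇Γ⟫ = 0` at every point
  (`IsAxisymmetric.inner_curl_gradient_swirl`, from the infinitesimal axisymmetry
  `Du(x)[Jx] = J u(x)`); for a classical solution on `[0, T)` with axisymmetric velocity and
  pressure the flat transport clause with `α = Γ`, `b = −(2/r) e_r` at interior times off the axis
  (`IsClassicalNSSolutionOn.deriv_swirl_transport`, = `swirl_transport_holds`); the tube estimate
  `vol({r < δ} ∩ B_ρ(x₀)) ≤ 8δ²ρ` (`volume_cylRadius_lt_inter_ball_le`, box bound); hence
  `IsClassicalNSSolutionOn.isFlatSwirlGaugeOn_swirl`: on a cylinder where `|Γ| ≤ M` and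
  `|ω| r ≤ C₀ |∇Γ|` (`8 ≤ C₀`), `(Γ, −(2/r)e_r, r, C₀, M)` is a flat swirl gauge, and
  `IsClassicalNSSolutionOn.hasFlatSwirlGauge_of_axisymmetric`.

## Design notes

* `IsFlatSwirlGaugeOn` is a plain conjunction (not a structure) so that `HasFlatSwirlGauge`
  unfolds by `δ`-reduction to the route's inline block (`hasFlatSwirlGauge_iff := Iff.rfl`).
* The transport clause uses the two-sided `deriv` in time (interior times of the open interval
  `(T − ρ², T)`), `convect`, Mathlib's Laplacian `Δ` and `gradient`, exactly as rendered by the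
  planner; `curl`/`gradient`/`Δ` carry Mathlib's junk value `0` at non-differentiable points, which
  is why the dilation lemmas below are stated without differentiability hypotheses.
* Deliberately NOT here: any existence statement (crux `FlatGaugeAtSingularity`), the
  Clebsch-connection defect / asymptotic flatness refinement (requested by the route only if its
  kill criterion K2 fires), maximum principles for `α`.

## References

* G. Koch, N. Nadirashvili, G. Seregin, V. Šverák, *Liouville theorems for the Navier–Stokes
  equations and applications*, Acta Math. 203 (2009) 83–105, eq. (1.8) (arXiv:0709.3599, §5: the
  equation for `r u_θ`, "(r u_θ)_t + u_r (r u_θ)_r + u_z (r u_θ)_z = Δ(r u_θ) − (2/r)(r u_θ)_r").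
  [KNSS2009]
* P. Constantin, *An Eulerian–Lagrangian approach to the Navier–Stokes equations*, Comm. Math.
  Phys. 216 (2001) 663–686 (diffusive Weber–Clebsch connection). [Constantin2001]
* N. Sato, *Realization of incompressible Navier–Stokes flow as superposition of transport
  processes for Clebsch potentials*, Phys. Fluids 33 (2021), §4. [Sato2021]
-/

noncomputable section

open MeasureTheory Set Function Filter Metric WithLp InnerProductSpace
open scoped Laplacian RealInnerProductSpace ENNReal Topology Pointwise

namespace Literature.Analysis.FluidPDE

/-- Local notation for physical space `ℝ³ = EuclideanSpace ℝ (Fin 3)`. -/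
local notation "ℝ³" => EuclideanSpace ℝ (Fin 3)

/-! ### The definition -/

/-- **Flat swirl gauge data** on the backward cylinder `Q_ρ(T, x₀) = (T − ρ², T) × B_ρ(x₀)` for the
velocity `u` and viscosity `ν`: `(α, b, d, C₀, M)` with `0 < ρ`, `ρ² < T`;
`α ∈ C²(Q)`; `vol({d(t,·) < δ} ∩ B_ρ(x₀)) ≤ C₀ δ² ρ` for `t ∈ (T − ρ², T)`, `0 < δ < ρ`; and at every
`(t, x) ∈ Q`: `|α| ≤ M`, `⟪curl u, ∇α⟫ = 0`, and where `d > 0`: `‖curl u‖ d ≤ C₀ ‖∇α‖`, `‖b‖ d ≤ C₀`,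
`∂ₜα + (u·∇)α = ν (Δα + ⟪b, ∇α⟫)`. Object posited by route `FlatSwirlGauge` (NavierStokesRegularity):
VERBATIM the body of the inline block of `stmt-NavierStokesRegularity-1252`; its exactly-flat model
is `α = Γ = r u_θ`, `b = −(2/r) e_r`, `d = r` for axisymmetric flow (KNSS 2009, (1.8);
`IsClassicalNSSolutionOn.isFlatSwirlGaugeOn_swirl`).
[cite: KNSS2009, eq. (1.8) (exactly-flat model; the general object is posited by route FlatSwirlGauge, not in print)] -/
def IsFlatSwirlGaugeOn (ν : ℝ) (u : ℝ → ℝ³ → ℝ³) (T : ℝ) (x₀ : ℝ³) (ρ C₀ M : ℝ)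
    (α : ℝ → ℝ³ → ℝ) (b : ℝ → ℝ³ → ℝ³) (d : ℝ → ℝ³ → ℝ) : Prop :=
  0 < ρ ∧ ρ ^ 2 < T ∧
    ContDiffOn ℝ 2 (uncurry α) (Ioo (T - ρ ^ 2) T ×ˢ ball x₀ ρ) ∧
    (∀ t ∈ Ioo (T - ρ ^ 2) T, ∀ δ ∈ Ioo 0 ρ,
      volume ({x | d t x < δ} ∩ ball x₀ ρ) ≤ ENNReal.ofReal (C₀ * δ ^ 2 * ρ)) ∧
    (∀ t ∈ Ioo (T - ρ ^ 2) T, ∀ x ∈ ball x₀ ρ,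
      |α t x| ≤ M ∧ ⟪curl (u t) x, gradient (α t) x⟫ = 0 ∧
        (0 < d t x →
          ‖curl (u t) x‖ * d t x ≤ C₀ * ‖gradient (α t) x‖ ∧ ‖b t x‖ * d t x ≤ C₀ ∧
            deriv (fun s => α s x) t + convect (u t) (α t) x =
              ν * ((Δ (α t)) x + ⟪b t x, gradient (α t) x⟫)))

/-- **`u` admits a flat swirl gauge at `(T, x₀)`** (viscosity `ν`): on SOME backward cylinder
`Q_ρ(T, x₀)` there are data `(α, b, d, C₀, M)` with `IsFlatSwirlGaugeOn ν u T x₀ ρ C₀ M α b d`.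
Letter for letter (after unfolding, `hasFlatSwirlGauge_iff`) the conclusion of the route decl
`Summit.NavierStokesRegularity.NavierStokesRegularity.Theses.FlatSwirlGauge.FlatGaugeAtSingularity`
and the gauge hypothesis of `CriticalSwirlRegularity` / `FlatGaugeExcludesTypeI`. No existence is
asserted here (that is the route's crux).
[cite: KNSS2009, eq. (1.8) (exactly-flat model; the general object is posited by route FlatSwirlGauge, not in print)] -/
def HasFlatSwirlGauge (ν : ℝ) (u : ℝ → ℝ³ → ℝ³) (T : ℝ) (x₀ : ℝ³) : Prop :=
  ∃ (ρ C₀ M : ℝ) (α : ℝ → ℝ³ → ℝ) (b : ℝ → ℝ³ → ℝ³) (d : ℝ → ℝ³ → ℝ),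
    IsFlatSwirlGaugeOn ν u T x₀ ρ C₀ M α b d

/-- `HasFlatSwirlGauge ν u T x₀` IS the inline v0 block of `stmt-NavierStokesRegularity-1252`
(conclusion of `FlatGaugeAtSingularity`, hypothesis of `CriticalSwirlRegularity` and
`FlatGaugeExcludesTypeI`), by `Iff.rfl`: restating the route decls over the notion changes no
meaning. [folklore] -/
theorem hasFlatSwirlGauge_iff (ν : ℝ) (u : ℝ → ℝ³ → ℝ³) (T : ℝ) (x₀ : ℝ³) :
    HasFlatSwirlGauge ν u T x₀ ↔
      ∃ (ρ C₀ M : ℝ) (α : ℝ → EuclideanSpace ℝ (Fin 3) → ℝ)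
        (b : ℝ → EuclideanSpace ℝ (Fin 3) → EuclideanSpace ℝ (Fin 3))
        (d : ℝ → EuclideanSpace ℝ (Fin 3) → ℝ), 0 < ρ ∧ ρ ^ 2 < T ∧
        ContDiffOn ℝ 2 (Function.uncurry α) (Set.Ioo (T - ρ ^ 2) T ×ˢ Metric.ball x₀ ρ) ∧
        (∀ t ∈ Set.Ioo (T - ρ ^ 2) T, ∀ δ ∈ Set.Ioo 0 ρ,
          MeasureTheory.volume ({x | d t x < δ} ∩ Metric.ball x₀ ρ) ≤
            ENNReal.ofReal (C₀ * δ ^ 2 * ρ)) ∧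
        (∀ t ∈ Set.Ioo (T - ρ ^ 2) T, ∀ x ∈ Metric.ball x₀ ρ, |α t x| ≤ M ∧
          inner ℝ (Literature.Analysis.FluidPDE.curl (u t) x) (gradient (α t) x) = 0 ∧
          (0 < d t x → ‖Literature.Analysis.FluidPDE.curl (u t) x‖ * d t x ≤ C₀ * ‖gradient (α t) x‖ ∧
            ‖b t x‖ * d t x ≤ C₀ ∧
            deriv (fun s => α s x) t + Literature.Analysis.FluidPDE.convect (u t) (α t) x =
              ν * (Laplacian.laplacian (α t) x + inner ℝ (b t x) (gradient (α t) x)))) :=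
  Iff.rfl

/-! ### Basic API: projections, sign of the constant, monotonicity, restriction -/

namespace IsFlatSwirlGaugeOn

variable {ν T ρ C₀ M : ℝ} {u : ℝ → ℝ³ → ℝ³} {x₀ : ℝ³} {α : ℝ → ℝ³ → ℝ} {b : ℝ → ℝ³ → ℝ³}
  {d : ℝ → ℝ³ → ℝ}

/-- The radius of a flat swirl gauge is positive. [folklore] -/
theorem radius_pos (h : IsFlatSwirlGaugeOn ν u T x₀ ρ C₀ M α b d) : 0 < ρ := h.1

/-- The cylinder of a flat swirl gauge lies above time `0`: `ρ² < T`. [folklore] -/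
theorem sq_radius_lt (h : IsFlatSwirlGaugeOn ν u T x₀ ρ C₀ M α b d) : ρ ^ 2 < T := h.2.1

/-- The momentum `α` of a flat swirl gauge is `C²` on the cylinder. [folklore] -/
theorem contDiffOn (h : IsFlatSwirlGaugeOn ν u T x₀ ρ C₀ M α b d) :
    ContDiffOn ℝ 2 (uncurry α) (Ioo (T - ρ ^ 2) T ×ˢ ball x₀ ρ) := h.2.2.1

/-- The volume clause of a flat swirl gauge: `vol({d < δ} ∩ B_ρ(x₀)) ≤ C₀ δ² ρ`. [folklore] -/
theorem volume_le (h : IsFlatSwirlGaugeOn ν u T x₀ ρ C₀ M α b d) {t : ℝ} (ht : t ∈ Ioo (T - ρ ^ 2) T)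
    {δ : ℝ} (hδ : δ ∈ Ioo 0 ρ) :
    volume ({x | d t x < δ} ∩ ball x₀ ρ) ≤ ENNReal.ofReal (C₀ * δ ^ 2 * ρ) := h.2.2.2.1 t ht δ hδ

/-- The momentum bound `|α| ≤ M` of a flat swirl gauge. [folklore] -/
theorem abs_le (h : IsFlatSwirlGaugeOn ν u T x₀ ρ C₀ M α b d) {t : ℝ} (ht : t ∈ Ioo (T - ρ ^ 2) T)
    {x : ℝ³} (hx : x ∈ ball x₀ ρ) : |α t x| ≤ M := (h.2.2.2.2 t ht x hx).1

/-- `α` is a first integral of the vorticity: `⟪curl u, ∇α⟫ = 0` on the cylinder. [folklore] -/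
theorem inner_curl_gradient (h : IsFlatSwirlGaugeOn ν u T x₀ ρ C₀ M α b d) {t : ℝ}
    (ht : t ∈ Ioo (T - ρ ^ 2) T) {x : ℝ³} (hx : x ∈ ball x₀ ρ) :
    ⟪curl (u t) x, gradient (α t) x⟫ = 0 := (h.2.2.2.2 t ht x hx).2.1

/-- Chart nondegeneracy off the degeneracy set: `‖curl u‖ d ≤ C₀ ‖∇α‖` where `d > 0`. [folklore] -/
theorem norm_curl_mul_le (h : IsFlatSwirlGaugeOn ν u T x₀ ρ C₀ M α b d) {t : ℝ}
    (ht : t ∈ Ioo (T - ρ ^ 2) T) {x : ℝ³} (hx : x ∈ ball x₀ ρ) (hd : 0 < d t x) :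
    ‖curl (u t) x‖ * d t x ≤ C₀ * ‖gradient (α t) x‖ := ((h.2.2.2.2 t ht x hx).2.2 hd).1

/-- The axis-type drift bound `‖b‖ d ≤ C₀` where `d > 0`. [folklore] -/
theorem norm_drift_mul_le (h : IsFlatSwirlGaugeOn ν u T x₀ ρ C₀ M α b d) {t : ℝ}
    (ht : t ∈ Ioo (T - ρ ^ 2) T) {x : ℝ³} (hx : x ∈ ball x₀ ρ) (hd : 0 < d t x) :
    ‖b t x‖ * d t x ≤ C₀ := ((h.2.2.2.2 t ht x hx).2.2 hd).2.1

/-- The flat transport law `∂ₜα + (u·∇)α = ν(Δα + ⟪b, ∇α⟫)` where `d > 0`. [folklore] -/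
theorem transport (h : IsFlatSwirlGaugeOn ν u T x₀ ρ C₀ M α b d) {t : ℝ}
    (ht : t ∈ Ioo (T - ρ ^ 2) T) {x : ℝ³} (hx : x ∈ ball x₀ ρ) (hd : 0 < d t x) :
    deriv (fun s => α s x) t + convect (u t) (α t) x =
      ν * ((Δ (α t)) x + ⟪b t x, gradient (α t) x⟫) := ((h.2.2.2.2 t ht x hx).2.2 hd).2.2

/-- Gauge data witness `HasFlatSwirlGauge`. [folklore] -/
theorem hasFlatSwirlGauge (h : IsFlatSwirlGaugeOn ν u T x₀ ρ C₀ M α b d) :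
    HasFlatSwirlGauge ν u T x₀ := ⟨ρ, C₀, M, α, b, d, h⟩

/-- **The gauge constant is nonnegative.** At an admissible time either some point of the ball has
`d > 0`, where `0 ≤ ‖b‖ d ≤ C₀`, or `d ≤ 0` on the whole ball, which is then contained in
`{d < ρ/2}` and has positive volume `≤ ofReal (C₀ (ρ/2)² ρ)`, impossible for `C₀ < 0`. [folklore] -/
theorem const_nonneg (h : IsFlatSwirlGaugeOn ν u T x₀ ρ C₀ M α b d) : 0 ≤ C₀ := by
  obtain ⟨hρ, -, -, hvol, hpt⟩ := h
  have hρ2 : 0 < ρ ^ 2 := by positivity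
  have ht : T - ρ ^ 2 / 2 ∈ Ioo (T - ρ ^ 2) T := ⟨by linarith, by linarith⟩
  by_contra hC
  push Not at hC
  have hd : ∀ x ∈ ball x₀ ρ, d (T - ρ ^ 2 / 2) x ≤ 0 := by
    intro x hx
    by_contra hdx
    push Not at hdx
    have h1 := ((hpt _ ht x hx).2.2 hdx).2.1
    have h0 : 0 ≤ ‖b (T - ρ ^ 2 / 2) x‖ * d (T - ρ ^ 2 / 2) x :=
      mul_nonneg (norm_nonneg _) hdx.le
    linarith
  have hδ : ρ / 2 ∈ Ioo 0 ρ := ⟨by positivity, by linarith⟩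
  have hsub : ball x₀ ρ ⊆ {x | d (T - ρ ^ 2 / 2) x < ρ / 2} ∩ ball x₀ ρ :=
    fun x hx => ⟨(hd x hx).trans_lt hδ.1, hx⟩
  have h1 := (measure_mono hsub).trans (hvol _ ht (ρ / 2) hδ)
  have hneg : C₀ * (ρ / 2) ^ 2 * ρ ≤ 0 := by
    have : 0 < (ρ / 2) ^ 2 * ρ := by positivity
    nlinarith
  rw [ENNReal.ofReal_of_nonpos hneg, nonpos_iff_eq_zero] at h1
  exact (measure_ball_pos volume x₀ hρ).ne' h1

/-- **Monotonicity in the constants**: larger `C₀`, `M` are again admissible. [folklore] -/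
theorem mono_const (h : IsFlatSwirlGaugeOn ν u T x₀ ρ C₀ M α b d) {C₀' M' : ℝ} (hC : C₀ ≤ C₀')
    (hM : M ≤ M') : IsFlatSwirlGaugeOn ν u T x₀ ρ C₀' M' α b d := by
  obtain ⟨hρ, hρT, hcd, hvol, hpt⟩ := h
  refine ⟨hρ, hρT, hcd, fun t ht δ hδ => (hvol t ht δ hδ).trans (ENNReal.ofReal_le_ofReal ?_),
    fun t ht x hx => ?_⟩
  · have : 0 ≤ δ ^ 2 * ρ := by positivity
    nlinarith
  · obtain ⟨h1, h2, h3⟩ := hpt t ht x hx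
    refine ⟨h1.trans hM, h2, fun hd => ?_⟩
    obtain ⟨h4, h5, h6⟩ := h3 hd
    exact ⟨h4.trans (mul_le_mul_of_nonneg_right hC (norm_nonneg _)), h5.trans hC, h6⟩

/-- **Restriction to a smaller cylinder.** The same data on `Q_{ρ'}(T, x₀)`, `0 < ρ' ≤ ρ`, are a flat
swirl gauge with momentum bound `M` and constant `C₀ ρ/ρ'` (`≥ C₀`): the pointwise clauses restrict
verbatim, while `vol({d < δ} ∩ B_{ρ'}) ≤ vol({d < δ} ∩ B_ρ) ≤ C₀ δ² ρ = (C₀ρ/ρ') δ² ρ'` — the volume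
clause as rendered is not monotone in the radius, so the constant is not literally kept. [folklore] -/
theorem restrict (h : IsFlatSwirlGaugeOn ν u T x₀ ρ C₀ M α b d) {ρ' : ℝ} (hρ' : 0 < ρ')
    (hle : ρ' ≤ ρ) : IsFlatSwirlGaugeOn ν u T x₀ ρ' (C₀ * (ρ / ρ')) M α b d := by
  have hC := h.const_nonneg
  obtain ⟨hρ, hρT, hcd, hvol, hpt⟩ := h
  have hsq : ρ' ^ 2 ≤ ρ ^ 2 := by nlinarith
  have hCle : C₀ ≤ C₀ * (ρ / ρ') := le_mul_of_one_le_right hC ((one_le_div hρ').2 hle)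
  have hI : Ioo (T - ρ' ^ 2) T ⊆ Ioo (T - ρ ^ 2) T := Ioo_subset_Ioo_left (by linarith)
  have hB : ball x₀ ρ' ⊆ ball x₀ ρ := ball_subset_ball hle
  refine ⟨hρ', hsq.trans_lt hρT, hcd.mono (prod_mono hI hB), fun t ht δ hδ => ?_,
    fun t ht x hx => ?_⟩
  · calc volume ({x | d t x < δ} ∩ ball x₀ ρ')
        ≤ volume ({x | d t x < δ} ∩ ball x₀ ρ) := measure_mono (inter_subset_inter_right _ hB)
      _ ≤ ENNReal.ofReal (C₀ * δ ^ 2 * ρ) := hvol t (hI ht) δ ⟨hδ.1, hδ.2.trans_le hle⟩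
      _ = ENNReal.ofReal (C₀ * (ρ / ρ') * δ ^ 2 * ρ') := by
          congr 1
          field_simp
  · obtain ⟨h1, h2, h3⟩ := hpt t (hI ht) x (hB hx)
    refine ⟨h1, h2, fun hd => ?_⟩
    obtain ⟨h4, h5, h6⟩ := h3 hd
    exact ⟨h4.trans (mul_le_mul_of_nonneg_right hCle (norm_nonneg _)), h5.trans hCle, h6⟩

end IsFlatSwirlGaugeOn

/-- A flat swirl gauge at `(T, x₀)` may be taken on a cylinder of any smaller radius
(`IsFlatSwirlGaugeOn.restrict`). [folklore] -/
theorem HasFlatSwirlGauge.exists_radius_le {ν T : ℝ} {u : ℝ → ℝ³ → ℝ³} {x₀ : ℝ³}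
    (h : HasFlatSwirlGauge ν u T x₀) {r : ℝ} (hr : 0 < r) :
    ∃ (ρ C₀ M : ℝ) (α : ℝ → ℝ³ → ℝ) (b : ℝ → ℝ³ → ℝ³) (d : ℝ → ℝ³ → ℝ),
      ρ ≤ r ∧ IsFlatSwirlGaugeOn ν u T x₀ ρ C₀ M α b d := by
  obtain ⟨ρ, C₀, M, α, b, d, hg⟩ := h
  exact ⟨min ρ r, C₀ * (ρ / min ρ r), M, α, b, d, min_le_right _ _,
    hg.restrict (lt_min hg.radius_pos hr) (min_le_left _ _)⟩

/-! ### Dilation calculus without differentiability hypotheses -/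

section Dilation

variable {F : Type*} [NormedAddCommGroup F] [NormedSpace ℝ F]

/-- `D(k • f(c ·))(x) = (k c) • Df(c x)` for all `k c : ℝ`, with no differentiability hypothesis
(Mathlib's `fderiv_comp_smul`, `fderiv_const_smul_field`; both sides are the junk value `0`
together). [folklore] -/
theorem fderiv_const_smul_comp_smul_apply (f : ℝ³ → F) (k c : ℝ) (x : ℝ³) :
    fderiv ℝ (fun y => k • f (c • y)) x = (k * c) • fderiv ℝ f (c • x) := by
  have h : (fun y => k • f (c • y)) = k • fun y => f (c • y) := rfl
  rw [h, fderiv_const_smul_field, Pi.smul_apply, _root_.fderiv_comp_smul, smul_smul]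

/-- `D²(f(c ·)) = z ↦ c² • D²f(c z)` (iterate `fderiv_const_smul_comp_smul_apply`). [folklore] -/
theorem fderiv_fderiv_comp_smul (f : ℝ³ → F) (c : ℝ) :
    fderiv ℝ (fderiv ℝ fun y => f (c • y)) = fun z => c ^ 2 • fderiv ℝ (fderiv ℝ f) (c • z) := by
  have h1 : (fderiv ℝ fun y => f (c • y)) = fun z => c • fderiv ℝ f (c • z) := by
    funext z
    simpa using fderiv_const_smul_comp_smul_apply f 1 c z
  rw [h1]
  funext z
  rw [fderiv_const_smul_comp_smul_apply (fderiv ℝ f) c c z, sq]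

/-- **Laplacian of a dilation**: `Δ(f(c ·))(x) = c² • (Δf)(c x)` for every `c : ℝ`, with no
differentiability hypothesis (`Δ = Σᵢ D²(eᵢ, eᵢ)` in an orthonormal frame). [folklore] -/
theorem laplacian_comp_smul_eq (f : ℝ³ → F) (c : ℝ) (x : ℝ³) :
    (Δ fun y => f (c • y)) x = c ^ 2 • (Δ f) (c • x) := by
  rw [laplacian_eq_iteratedFDeriv_stdOrthonormalBasis,
    laplacian_eq_iteratedFDeriv_stdOrthonormalBasis]
  simp only [iteratedFDeriv_two_apply, Finset.smul_sum, fderiv_fderiv_comp_smul f c]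
  simp

/-- **Gradient of a dilation**: `∇(f(c ·))(x) = c • (∇f)(c x)` for every `c : ℝ`, no
differentiability hypothesis. [folklore] -/
theorem gradient_comp_smul (f : ℝ³ → ℝ) (c : ℝ) (x : ℝ³) :
    gradient (fun y => f (c • y)) x = c • gradient f (c • x) := by
  simp only [gradient, _root_.fderiv_comp_smul, map_smul]

/-- **Curl of a dilation**: `curl (k • v(c ·))(x) = (k c) • (curl v)(c x)` for all `k c : ℝ`, no
differentiability hypothesis. [folklore] -/
theorem curl_smul_comp_smul (v : ℝ³ → ℝ³) (k c : ℝ) (x : ℝ³) :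
    curl (fun y => k • v (c • y)) x = (k * c) • curl v (c • x) := by
  simp only [curl, fderiv_const_smul_comp_smul_apply v k c x, _root_.smul_apply,
    PiLp.smul_apply, smul_eq_mul]
  ext i
  fin_cases i <;> simp <;> ring

end Dilation

/-! ### Scaling covariance -/

/-- Lebesgue measure of a dilate in `ℝ³`: `vol(c • s) = |c|³ vol(s)` (Mathlib's `addHaar_smul`). [folklore] -/
theorem volume_smul_set_euclidean_three (c : ℝ) (s : Set ℝ³) :
    volume (c • s) = ENNReal.ofReal (|c| ^ 3) * volume s := by
  rw [Measure.addHaar_smul, finrank_euclideanSpace_fin, abs_pow]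

namespace IsFlatSwirlGaugeOn

variable {ν T ρ C₀ M : ℝ} {u : ℝ → ℝ³ → ℝ³} {x₀ : ℝ³} {α : ℝ → ℝ³ → ℝ} {b : ℝ → ℝ³ → ℝ³}
  {d : ℝ → ℝ³ → ℝ}

/-- **NS-scaling covariance of flat swirl gauges.** Under the parabolic rescaling
`u_c(t, x) = c u(c²t, cx)` (`nsRescale c u`, `0 < c`), the data
`(α(c²t, cx), c b(c²t, cx), c⁻¹ d(c²t, cx))` are a flat swirl gauge for `u_c` at `(T/c², x₀/c)` on
the cylinder of radius `ρ/c`, with THE SAME constants `C₀, M` (`α` has the dimension of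
circulation, `b` of inverse length, `d` of length; every clause is scale-invariant:
`curl u_c = c² (curl u)∘`, `∇α_c = c (∇α)∘`, `Δ`, `∂ₜ`, `(u·∇)` all scale by `c²`, and
`vol(c⁻¹ • S) = c⁻³ vol(S)`). [folklore] -/
theorem nsRescale (h : IsFlatSwirlGaugeOn ν u T x₀ ρ C₀ M α b d) {c : ℝ} (hc : 0 < c) :
    IsFlatSwirlGaugeOn ν (FluidPDE.nsRescale c u) (T / c ^ 2) (c⁻¹ • x₀) (ρ / c) C₀ M
      (fun t x => α (c ^ 2 * t) (c • x)) (fun t x => c • b (c ^ 2 * t) (c • x))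
      (fun t x => c⁻¹ * d (c ^ 2 * t) (c • x)) := by
  obtain ⟨hρ, hρT, hcd, hvol, hpt⟩ := h
  have hc0 : c ≠ 0 := hc.ne'
  have hc2 : 0 < c ^ 2 := by positivity
  -- the parameter map sends the rescaled cylinder into the original one
  have htime : ∀ {t : ℝ}, t ∈ Ioo (T / c ^ 2 - (ρ / c) ^ 2) (T / c ^ 2) →
      c ^ 2 * t ∈ Ioo (T - ρ ^ 2) T := by
    intro t ht
    have h1 : c ^ 2 * (T / c ^ 2 - (ρ / c) ^ 2) = T - ρ ^ 2 := by field_simp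
    have h2 : c ^ 2 * (T / c ^ 2) = T := by field_simp
    exact ⟨h1 ▸ mul_lt_mul_of_pos_left ht.1 hc2, h2 ▸ mul_lt_mul_of_pos_left ht.2 hc2⟩
  have hspace_iff : ∀ {x : ℝ³}, x ∈ ball (c⁻¹ • x₀) (ρ / c) ↔ c • x ∈ ball x₀ ρ := by
    intro x
    rw [mem_ball, mem_ball, dist_eq_norm, dist_eq_norm,
      show c • x - x₀ = c • (x - c⁻¹ • x₀) by rw [smul_sub, smul_inv_smul₀ hc0], norm_smul,
      Real.norm_eq_abs, abs_of_pos hc, lt_div_iff₀ hc, mul_comm]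
  refine ⟨div_pos hρ hc, ?_, ?_, ?_, ?_⟩
  · rw [div_pow]
    exact div_lt_div_of_pos_right hρT hc2
  · have hφ : ContDiff ℝ 2 (fun q : ℝ × ℝ³ => (c ^ 2 * q.1, c • q.2)) := by fun_prop
    refine (hcd.comp hφ.contDiffOn fun q hq => ⟨htime hq.1, hspace_iff.1 hq.2⟩).congr ?_
    intro q _
    rfl
  · intro t ht δ hδ
    have hset : {x : ℝ³ | c⁻¹ * d (c ^ 2 * t) (c • x) < δ} ∩ ball (c⁻¹ • x₀) (ρ / c) =
        c⁻¹ • ({y : ℝ³ | d (c ^ 2 * t) y < c * δ} ∩ ball x₀ ρ) := by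
      ext x
      rw [Set.mem_inv_smul_set_iff₀ hc0, mem_inter_iff, mem_inter_iff, mem_setOf_eq, mem_setOf_eq,
        hspace_iff, inv_mul_lt_iff₀ hc]
    have hcδ : c * δ ∈ Ioo 0 ρ := by
      refine ⟨mul_pos hc hδ.1, ?_⟩
      have := mul_lt_mul_of_pos_left hδ.2 hc
      rwa [mul_div_cancel₀ _ hc0] at this
    rw [hset, volume_smul_set_euclidean_three, abs_of_pos (inv_pos.2 hc)]
    calc ENNReal.ofReal (c⁻¹ ^ 3) * volume ({y : ℝ³ | d (c ^ 2 * t) y < c * δ} ∩ ball x₀ ρ)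
        ≤ ENNReal.ofReal (c⁻¹ ^ 3) * ENNReal.ofReal (C₀ * (c * δ) ^ 2 * ρ) := by
          gcongr
          exact hvol _ (htime ht) _ hcδ
      _ = ENNReal.ofReal (C₀ * δ ^ 2 * (ρ / c)) := by
          rw [← ENNReal.ofReal_mul (by positivity)]
          congr 1
          field_simp
  · intro t ht x hx
    obtain ⟨h1, h2, h3⟩ := hpt (c ^ 2 * t) (htime ht) (c • x) (hspace_iff.1 hx)
    have hcurl : curl (FluidPDE.nsRescale c u t) x = c ^ 2 • curl (u (c ^ 2 * t)) (c • x) := by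
      rw [show FluidPDE.nsRescale c u t = fun y => c • u (c ^ 2 * t) (c • y) from rfl,
        curl_smul_comp_smul, sq]
    have hgrad : gradient (fun y => α (c ^ 2 * t) (c • y)) x =
        c • gradient (α (c ^ 2 * t)) (c • x) := gradient_comp_smul _ c x
    refine ⟨h1, ?_, fun hd => ?_⟩
    · show ⟪curl (FluidPDE.nsRescale c u t) x, gradient (fun y => α (c ^ 2 * t) (c • y)) x⟫ = 0
      rw [hcurl, hgrad, real_inner_smul_left, real_inner_smul_right, h2, mul_zero, mul_zero]
    · have hd' : 0 < d (c ^ 2 * t) (c • x) := (mul_pos_iff_of_pos_left (inv_pos.2 hc)).1 hd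
      obtain ⟨h4, h5, h6⟩ := h3 hd'
      refine ⟨?_, ?_, ?_⟩
      · show ‖curl (FluidPDE.nsRescale c u t) x‖ * (c⁻¹ * d (c ^ 2 * t) (c • x)) ≤
          C₀ * ‖gradient (fun y => α (c ^ 2 * t) (c • y)) x‖
        rw [hcurl, hgrad, norm_smul, norm_smul, Real.norm_eq_abs, Real.norm_eq_abs, abs_of_pos hc2,
          abs_of_pos hc]
        calc c ^ 2 * ‖curl (u (c ^ 2 * t)) (c • x)‖ * (c⁻¹ * d (c ^ 2 * t) (c • x))
            = c * (‖curl (u (c ^ 2 * t)) (c • x)‖ * d (c ^ 2 * t) (c • x)) := by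
              field_simp
          _ ≤ c * (C₀ * ‖gradient (α (c ^ 2 * t)) (c • x)‖) := mul_le_mul_of_nonneg_left h4 hc.le
          _ = C₀ * (c * ‖gradient (α (c ^ 2 * t)) (c • x)‖) := by ring
      · show ‖c • b (c ^ 2 * t) (c • x)‖ * (c⁻¹ * d (c ^ 2 * t) (c • x)) ≤ C₀
        rw [norm_smul, Real.norm_eq_abs, abs_of_pos hc]
        calc c * ‖b (c ^ 2 * t) (c • x)‖ * (c⁻¹ * d (c ^ 2 * t) (c • x))
            = ‖b (c ^ 2 * t) (c • x)‖ * d (c ^ 2 * t) (c • x) := by field_simp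
          _ ≤ C₀ := h5
      · show deriv (fun s => α (c ^ 2 * s) (c • x)) t +
            convect (FluidPDE.nsRescale c u t) (fun y => α (c ^ 2 * t) (c • y)) x =
          ν * ((Δ fun y => α (c ^ 2 * t) (c • y)) x +
            ⟪c • b (c ^ 2 * t) (c • x), gradient (fun y => α (c ^ 2 * t) (c • y)) x⟫)
        have hderiv : deriv (fun s => α (c ^ 2 * s) (c • x)) t =
            c ^ 2 * deriv (fun s => α s (c • x)) (c ^ 2 * t) := by
          simpa using deriv_comp_mul_left (c ^ 2) (fun s => α s (c • x)) t
        have hconv : convect (FluidPDE.nsRescale c u t) (fun y => α (c ^ 2 * t) (c • y)) x =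
            c ^ 2 * convect (u (c ^ 2 * t)) (α (c ^ 2 * t)) (c • x) := by
          simp only [convect_apply, FluidPDE.nsRescale_apply, _root_.fderiv_comp_smul,
            _root_.smul_apply, map_smul, smul_eq_mul]
          ring
        have hlap : (Δ fun y => α (c ^ 2 * t) (c • y)) x = c ^ 2 * (Δ (α (c ^ 2 * t))) (c • x) := by
          rw [laplacian_comp_smul_eq]
          rfl
        rw [hderiv, hconv, hlap, hgrad, real_inner_smul_left, real_inner_smul_right, ← mul_add, h6]
        ring

end IsFlatSwirlGaugeOn

/-- **Scaling covariance of `HasFlatSwirlGauge`**: `u` has a flat swirl gauge at `(T, x₀)` iff its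
NS rescaling `u_c = c u(c²·, c·)` (`0 < c`) has one at `(T/c², x₀/c)`; forward direction. [folklore] -/
theorem HasFlatSwirlGauge.nsRescale {ν T : ℝ} {u : ℝ → ℝ³ → ℝ³} {x₀ : ℝ³}
    (h : HasFlatSwirlGauge ν u T x₀) {c : ℝ} (hc : 0 < c) :
    HasFlatSwirlGauge ν (FluidPDE.nsRescale c u) (T / c ^ 2) (c⁻¹ • x₀) := by
  obtain ⟨ρ, C₀, M, α, b, d, hg⟩ := h
  exact (hg.nsRescale hc).hasFlatSwirlGauge

/-- **Scaling invariance of `HasFlatSwirlGauge`** (both directions, via `nsRescale c⁻¹ ∘ nsRescale c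
= id`). [folklore] -/
theorem hasFlatSwirlGauge_nsRescale_iff {ν T : ℝ} {u : ℝ → ℝ³ → ℝ³} {x₀ : ℝ³} {c : ℝ}
    (hc : 0 < c) :
    HasFlatSwirlGauge ν (FluidPDE.nsRescale c u) (T / c ^ 2) (c⁻¹ • x₀) ↔
      HasFlatSwirlGauge ν u T x₀ := by
  refine ⟨fun h => ?_, fun h => h.nsRescale hc⟩
  have h' := h.nsRescale (inv_pos.2 hc)
  rwa [nsRescale_inv_nsRescale hc.ne', inv_inv, smul_inv_smul₀ hc.ne',
    show T / c ^ 2 / c⁻¹ ^ 2 = T by field_simp] at h'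

/-! ### Translation covariance (space) -/

section Translation

variable {F : Type*} [NormedAddCommGroup F] [NormedSpace ℝ F]

/-- **Gradient of a translate**: `∇(f(· + a))(x) = (∇f)(x + a)`, no differentiability hypothesis
(Mathlib's `fderiv_comp_add_right`). [folklore] -/
theorem gradient_comp_add_const (f : ℝ³ → ℝ) (a x : ℝ³) :
    gradient (fun y => f (y + a)) x = gradient f (x + a) := by
  simp only [gradient, fderiv_comp_add_right]

/-- **Curl of a translate**: `curl (v(· + a))(x) = (curl v)(x + a)`, no differentiability
hypothesis. [folklore] -/
theorem curl_comp_add_const (v : ℝ³ → ℝ³) (a x : ℝ³) :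
    curl (fun y => v (y + a)) x = curl v (x + a) := by
  simp only [curl, fderiv_comp_add_right]

/-- **Laplacian of a translate**: `Δ(f(· + a))(x) = (Δf)(x + a)`, no differentiability hypothesis
(Mathlib's `iteratedFDeriv_comp_add_right`). [folklore] -/
theorem laplacian_comp_add_const (f : ℝ³ → F) (a x : ℝ³) :
    (Δ fun y => f (y + a)) x = (Δ f) (x + a) := by
  rw [laplacian_eq_iteratedFDeriv_stdOrthonormalBasis,
    laplacian_eq_iteratedFDeriv_stdOrthonormalBasis]
  simp only [iteratedFDeriv_comp_add_right]

end Translation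

namespace IsFlatSwirlGaugeOn

variable {ν T ρ C₀ M : ℝ} {u : ℝ → ℝ³ → ℝ³} {x₀ : ℝ³} {α : ℝ → ℝ³ → ℝ} {b : ℝ → ℝ³ → ℝ³}
  {d : ℝ → ℝ³ → ℝ}

/-- **Translation covariance of flat swirl gauges** (space): for `a : ℝ³`, translating all data,
`u'(t, x) = u(t, x + a)` etc., gives a flat swirl gauge at `(T, x₀ − a)` with the same radius and
constants (Lebesgue measure is translation invariant; `curl`, `∇`, `Δ`, `(u·∇)` commute with
translations). Normalises `x₀ = 0`. [folklore] -/
theorem translate (h : IsFlatSwirlGaugeOn ν u T x₀ ρ C₀ M α b d) (a : ℝ³) :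
    IsFlatSwirlGaugeOn ν (fun t x => u t (x + a)) T (x₀ - a) ρ C₀ M (fun t x => α t (x + a))
      (fun t x => b t (x + a)) (fun t x => d t (x + a)) := by
  obtain ⟨hρ, hρT, hcd, hvol, hpt⟩ := h
  have hball : ∀ {x : ℝ³}, x ∈ ball (x₀ - a) ρ ↔ x + a ∈ ball x₀ ρ := by
    intro x
    rw [mem_ball, mem_ball, dist_eq_norm, dist_eq_norm, sub_sub_eq_add_sub]
  refine ⟨hρ, hρT, ?_, fun t ht δ hδ => ?_, fun t ht x hx => ?_⟩
  · have hφ : ContDiff ℝ 2 (fun q : ℝ × ℝ³ => (q.1, q.2 + a)) := by fun_prop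
    refine (hcd.comp hφ.contDiffOn fun q hq => ⟨hq.1, hball.1 hq.2⟩).congr ?_
    intro q _
    rfl
  · have hset : {x : ℝ³ | d t (x + a) < δ} ∩ ball (x₀ - a) ρ =
        (fun x => x + a) ⁻¹' ({y : ℝ³ | d t y < δ} ∩ ball x₀ ρ) := by
      ext x
      simp only [mem_inter_iff, mem_setOf_eq, mem_preimage, hball]
    rw [hset, measure_preimage_add_right]
    exact hvol t ht δ hδ
  · obtain ⟨h1, h2, h3⟩ := hpt t ht (x + a) (hball.1 hx)
    have hcurl : curl (fun y => u t (y + a)) x = curl (u t) (x + a) := curl_comp_add_const _ a x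
    have hgrad : gradient (fun y => α t (y + a)) x = gradient (α t) (x + a) :=
      gradient_comp_add_const _ a x
    refine ⟨h1, ?_, fun hd => ?_⟩
    · show ⟪curl (fun y => u t (y + a)) x, gradient (fun y => α t (y + a)) x⟫ = 0
      rw [hcurl, hgrad, h2]
    · obtain ⟨h4, h5, h6⟩ := h3 hd
      refine ⟨?_, h5, ?_⟩
      · show ‖curl (fun y => u t (y + a)) x‖ * d t (x + a) ≤ C₀ * ‖gradient (fun y => α t (y + a)) x‖
        rw [hcurl, hgrad]
        exact h4
      · show deriv (fun s => α s (x + a)) t + convect (fun y => u t (y + a)) (fun y => α t (y + a)) x =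
          ν * ((Δ fun y => α t (y + a)) x + ⟪b t (x + a), gradient (fun y => α t (y + a)) x⟫)
        have hconv : convect (fun y => u t (y + a)) (fun y => α t (y + a)) x =
            convect (u t) (α t) (x + a) := by
          simp only [convect_apply, fderiv_comp_add_right]
        rw [hconv, laplacian_comp_add_const, hgrad, h6]

end IsFlatSwirlGaugeOn

/-- **Translation covariance of `HasFlatSwirlGauge`** (space). [folklore] -/
theorem HasFlatSwirlGauge.translate {ν T : ℝ} {u : ℝ → ℝ³ → ℝ³} {x₀ : ℝ³}
    (h : HasFlatSwirlGauge ν u T x₀) (a : ℝ³) :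
    HasFlatSwirlGauge ν (fun t x => u t (x + a)) T (x₀ - a) := by
  obtain ⟨ρ, C₀, M, α, b, d, hg⟩ := h
  exact (hg.translate a).hasFlatSwirlGauge

/-- **Translation invariance of `HasFlatSwirlGauge`** (space, both directions). [folklore] -/
theorem hasFlatSwirlGauge_translate_iff {ν T : ℝ} {u : ℝ → ℝ³ → ℝ³} {x₀ : ℝ³} (a : ℝ³) :
    HasFlatSwirlGauge ν (fun t x => u t (x + a)) T (x₀ - a) ↔ HasFlatSwirlGauge ν u T x₀ := by
  refine ⟨fun h => ?_, fun h => h.translate a⟩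
  have h' := h.translate (-a)
  simp only [sub_neg_eq_add, sub_add_cancel, neg_add_cancel_right] at h'
  exact h'

/-! ### The exactly-flat anchor: the swirl of an axisymmetric flow -/

/-- **The swirl is a first integral of the vorticity of an axisymmetric field**:
`⟪curl u (x), ∇Γ(x)⟫ = 0` at EVERY point, `Γ = swirl u = x₀u₁ − x₁u₀` (in cylindrical components
`ω = −∂_z u_θ e_r + ω_θ e_θ + r⁻¹∂ᵣ(r u_θ) e_z` and `∇Γ = ∂ᵣΓ e_r + ∂_zΓ e_z`, KNSS 2009, §1).
Proof: `DΓ(x)h = ⟪Jx, Du(x)h⟫ + ⟪Jh, u(x)⟫` (`fderiv_swirl_apply`) and the three components of the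
infinitesimal axisymmetry `Du(x)[Jx] = J u(x)` (`IsAxisymmetric.fderiv_rotGen`) give
`⟪ω, ∇Γ⟫ = Σᵢ ωᵢ Rᵢ = 0`; where `u` is not differentiable both `curl` and the claim are trivial.
[cite: KNSS2009, §1 (1.5)–(1.8)] -/
theorem IsAxisymmetric.inner_curl_gradient_swirl {u : ℝ³ → ℝ³} (hu : IsAxisymmetric u) (x : ℝ³) :
    ⟪curl u x, gradient (swirl u) x⟫ = 0 := by
  by_cases hd : DifferentiableAt ℝ u x
  · -- the three components of `Du(x)[Jx] = J u(x)`
    have hJ := hu.fderiv_rotGen hd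
    rw [rotGen_eq_sub_single, map_sub, map_smul, map_smul] at hJ
    have hA := congrArg (fun v : ℝ³ => v 0) hJ
    have hB := congrArg (fun v : ℝ³ => v 1) hJ
    have hC := congrArg (fun v : ℝ³ => v 2) hJ
    simp only [PiLp.sub_apply, PiLp.smul_apply, smul_eq_mul, rotGen_apply_zero,
      rotGen_apply_one, rotGen_apply_two] at hA hB hC
    -- expand `⟪ω, ∇Γ⟫ = DΓ(x)[ω]` with `ω` written in the standard basis
    have hω : curl u x =
        (fderiv ℝ u x (EuclideanSpace.single 1 1) 2 - fderiv ℝ u x (EuclideanSpace.single 2 1) 1) •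
            EuclideanSpace.single 0 (1 : ℝ) +
          (fderiv ℝ u x (EuclideanSpace.single 2 1) 0 - fderiv ℝ u x (EuclideanSpace.single 0 1) 2) •
            EuclideanSpace.single 1 (1 : ℝ) +
          (fderiv ℝ u x (EuclideanSpace.single 0 1) 1 - fderiv ℝ u x (EuclideanSpace.single 1 1) 0) •
            EuclideanSpace.single 2 (1 : ℝ) := by
      ext i
      fin_cases i <;> simp [curl]
    rw [real_inner_comm, gradient, toDual_symm_apply, fderiv_swirl_apply hd, hω]
    simp only [map_add, map_smul, inner_add_right, inner_smul_right, rotGen_add, rotGen_smul,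
      rotGen_single_zero, rotGen_single_one, rotGen_single_two, inner_add_left, inner_smul_left,
      inner_neg_left, inner_rotGen_left, EuclideanSpace.inner_single_left, map_one, one_mul,
      RCLike.conj_to_real, smul_zero, add_zero]
    linear_combination
      (fderiv ℝ u x (EuclideanSpace.single 1 1) 2 - fderiv ℝ u x (EuclideanSpace.single 2 1) 1) * hA +
        (fderiv ℝ u x (EuclideanSpace.single 2 1) 0 - fderiv ℝ u x (EuclideanSpace.single 0 1) 2) * hB +
        (fderiv ℝ u x (EuclideanSpace.single 0 1) 1 - fderiv ℝ u x (EuclideanSpace.single 1 1) 0) * hC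
  · have h0 : curl u x = 0 := by
      ext i
      fin_cases i <;> simp [curl, fderiv_zero_of_not_differentiableAt hd]
    rw [h0, inner_zero_left]

/-- **The flat transport clause for `α = Γ`, `b = −(2/r) e_r`** (the exactly-flat case of the gauge):
for a classical Navier–Stokes solution on `ℝ³ × [0, T)` (any `ν`, no force) with axisymmetric
velocity and pressure, at interior times `0 < t < T` and off the axis,
`∂ₜΓ + (u·∇)Γ = ν (ΔΓ + ⟪−(2/r) e_r, ∇Γ⟫)`. This is KNSS 2009, eq. (1.8)
(`swirl_transport_holds`) after identifying the two-sided `deriv` with `derivWithin (Ico 0 T)` at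
interior times and `⟪e_r, ∇Γ⟫ = ∂ᵣΓ`. [cite: KNSS2009, eq. (1.8)] -/
theorem IsClassicalNSSolutionOn.deriv_swirl_transport {ν T : ℝ} {u : ℝ → ℝ³ → ℝ³}
    {p : ℝ → ℝ³ → ℝ} (h : IsClassicalNSSolutionOn (Ico 0 T) ν 0 u p)
    (hu : ∀ t ∈ Ico 0 T, IsAxisymmetric (u t)) (hp : ∀ t ∈ Ico 0 T, IsAxisymmetricScalar (p t))
    {t : ℝ} (ht : t ∈ Ioo 0 T) {x : ℝ³} (hx : cylRadius x ≠ 0) :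
    deriv (fun s => swirl (u s) x) t + convect (u t) (swirl (u t)) x =
      ν * ((Δ (swirl (u t))) x + ⟪(-(2 / cylRadius x)) • eR x, gradient (swirl (u t)) x⟫) := by
  have ht' : t ∈ Ico 0 T := ⟨ht.1.le, ht.2⟩
  have hmain := swirl_transport_holds h hu hp ht' hx
  have hderiv : deriv (fun s => swirl (u s) x) t =
      timeDerivWithin (Ico 0 T) (fun s => swirl (u s)) t x := by
    rw [timeDerivWithin_apply, derivWithin_of_mem_nhds (Ico_mem_nhds ht.1 ht.2)]
  have hswirl0 : swirl ((0 : ℝ → ℝ³ → ℝ³) t) x = 0 := by simp [swirl]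
  have hdir : ⟪(-(2 / cylRadius x)) • eR x, gradient (swirl (u t)) x⟫ =
      -(2 / cylRadius x) * partialDeriv (eR x) (swirl (u t)) x := by
    rw [real_inner_smul_left, real_inner_comm, gradient, toDual_symm_apply, partialDeriv_apply]
  rw [hderiv, hmain, hswirl0, hdir]
  ring

/-- The swirl of a jointly smooth velocity is jointly `C²` (indeed smooth) in `(t, x)`:
`Γ(t, x) = ⟪J x, u(t, x)⟫`. [folklore] -/
theorem IsSmoothSpaceTimeOn.contDiffOn_uncurry_swirl {S : Set ℝ} {u : ℝ → ℝ³ → ℝ³}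
    (h : IsSmoothSpaceTimeOn S u) :
    ContDiffOn ℝ 2 (uncurry fun t x => swirl (u t) x) (S ×ˢ univ) := by
  have h1 : (uncurry fun t x => swirl (u t) x) = fun q : ℝ × ℝ³ => ⟪rotGen q.2, uncurry u q⟫ := by
    funext q
    simp [uncurry, inner_rotGen_left, swirl]
  rw [h1]
  have h2 : ContDiffOn ℝ 2 (uncurry u) (S ×ˢ univ) := h.of_le (by norm_cast)
  exact ((rotGenL.contDiff.comp contDiff_snd).contDiffOn).inner ℝ h2

/-- **The thin tube around the axis is axis-like**: `vol({r < δ} ∩ B_ρ(x₀)) ≤ 8 δ² ρ`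
(`0 ≤ δ`; for `ρ ≤ 0` both sides vanish): the set lies in the box `(−δ, δ)² × (x₀₂ − ρ, x₀₂ + ρ)`, whose Lebesgue measure
is `(2δ)²(2ρ)` (volume-preserving identification `EuclideanSpace ℝ (Fin 3) ≃ (Fin 3 → ℝ)` and
`Real.volume_pi_Ioo`). [folklore] -/
theorem volume_cylRadius_lt_inter_ball_le (x₀ : ℝ³) {δ : ℝ} (ρ : ℝ) (hδ : 0 ≤ δ) :
    volume ({x : ℝ³ | cylRadius x < δ} ∩ ball x₀ ρ) ≤ ENNReal.ofReal (8 * δ ^ 2 * ρ) := by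
  set lo : Fin 3 → ℝ := ![-δ, -δ, x₀ 2 - ρ] with hlo
  set hi : Fin 3 → ℝ := ![δ, δ, x₀ 2 + ρ] with hhi
  have hsub : {x : ℝ³ | cylRadius x < δ} ∩ ball x₀ ρ ⊆
      (fun x : ℝ³ => (ofLp x : Fin 3 → ℝ)) ⁻¹' Set.pi univ fun i => Ioo (lo i) (hi i) := by
    rintro x ⟨hr, hb⟩
    rw [mem_setOf_eq] at hr
    rw [mem_ball, dist_eq_norm] at hb
    have hr0 : 0 ≤ cylRadius x := cylRadius_nonneg x
    have hsq : cylRadius x ^ 2 < δ ^ 2 := by nlinarith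
    rw [cylRadius_sq] at hsq
    have h0 : |x 0| < δ := abs_lt_of_sq_lt_sq (by nlinarith [sq_nonneg (x 1)]) hδ
    have h1 : |x 1| < δ := abs_lt_of_sq_lt_sq (by nlinarith [sq_nonneg (x 0)]) hδ
    have h2 : |x 2 - x₀ 2| < ρ := by
      have := PiLp.norm_apply_le (x - x₀) 2
      rw [PiLp.sub_apply, Real.norm_eq_abs] at this
      exact this.trans_lt hb
    rw [abs_lt] at h0 h1 h2
    rw [mem_preimage, mem_univ_pi]
    intro i
    fin_cases i
    · simpa [hlo, hhi] using h0
    · simpa [hlo, hhi] using h1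
    · have h2' : x₀ 2 - ρ < x 2 ∧ x 2 < x₀ 2 + ρ := ⟨by linarith [h2.1], by linarith [h2.2]⟩
      simpa [hlo, hhi] using h2'
  calc volume ({x : ℝ³ | cylRadius x < δ} ∩ ball x₀ ρ)
      ≤ volume ((fun x : ℝ³ => (ofLp x : Fin 3 → ℝ)) ⁻¹' Set.pi univ fun i => Ioo (lo i) (hi i)) :=
        measure_mono hsub
    _ = volume (Set.pi univ fun i => Ioo (lo i) (hi i)) :=
        (PiLp.volume_preserving_ofLp (Fin 3)).measure_preimage
          (MeasurableSet.univ_pi fun _ => measurableSet_Ioo).nullMeasurableSet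
    _ = ENNReal.ofReal (8 * δ ^ 2 * ρ) := by
        rw [Real.volume_pi_Ioo, Fin.prod_univ_three]
        simp only [hlo, hhi, Matrix.cons_val_zero, Matrix.cons_val_one, Matrix.cons_val_two,
          Matrix.head_cons, Matrix.tail_cons]
        rw [← ENNReal.ofReal_mul (by linarith), ← ENNReal.ofReal_mul (by nlinarith)]
        congr 1
        ring

/-- `‖e_r‖ = 1` off the axis. [folklore] -/
private theorem norm_eR_eq_one_of_ne {x : ℝ³} (hx : cylRadius x ≠ 0) : ‖eR x‖ = 1 := by
  have hr : 0 ≤ cylRadius x := cylRadius_nonneg x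
  have hn : ‖(toLp 2 ![x 0, x 1, 0] : ℝ³)‖ = cylRadius x := by
    rw [EuclideanSpace.norm_eq, cylRadius]
    congr 1
    simp [Fin.sum_univ_three]
  rw [eR, norm_smul, norm_inv, Real.norm_eq_abs, abs_of_nonneg hr, hn, inv_mul_cancel₀ hx]

/-- **The exactly-flat anchor of the v0 rendering.** For a classical Navier–Stokes solution on
`ℝ³ × [0, T)` (any `ν`, no force) with axisymmetric velocity and pressure, and a backward cylinder
`Q_ρ(T, x₀)` (`0 < ρ`, `ρ² < T`) on which `|Γ| ≤ M` and `‖curl u‖ r ≤ C₀ ‖∇Γ‖` with `8 ≤ C₀`, the data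
`α = Γ = swirl u` (KNSS 2009, (1.8)), `b = −(2/r) e_r`, `d = r = cylRadius` form a flat swirl gauge
with constants `C₀, M`: `⟪ω, ∇Γ⟫ = 0` (`IsAxisymmetric.inner_curl_gradient_swirl`), the flat
transport law (`IsClassicalNSSolutionOn.deriv_swirl_transport`), `‖b‖ d = 2 ≤ C₀`, and the tube
estimate `vol({r < δ} ∩ B_ρ) ≤ 8δ²ρ ≤ C₀δ²ρ` (`volume_cylRadius_lt_inter_ball_le`). The bounds on `Γ`
and on `‖ω‖ r / ‖∇Γ‖` are hypotheses (the poloidal-dominated regime of the route). [cite: KNSS2009, eq. (1.8)] -/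
theorem IsClassicalNSSolutionOn.isFlatSwirlGaugeOn_swirl {ν T : ℝ} {u : ℝ → ℝ³ → ℝ³}
    {p : ℝ → ℝ³ → ℝ} (h : IsClassicalNSSolutionOn (Ico 0 T) ν 0 u p)
    (hu : ∀ t ∈ Ico 0 T, IsAxisymmetric (u t)) (hp : ∀ t ∈ Ico 0 T, IsAxisymmetricScalar (p t))
    {x₀ : ℝ³} {ρ C₀ M : ℝ} (hρ : 0 < ρ) (hρT : ρ ^ 2 < T) (hC₀ : 8 ≤ C₀)
    (hM : ∀ t ∈ Ioo (T - ρ ^ 2) T, ∀ x ∈ ball x₀ ρ, |swirl (u t) x| ≤ M)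
    (hω : ∀ t ∈ Ioo (T - ρ ^ 2) T, ∀ x ∈ ball x₀ ρ,
      ‖curl (u t) x‖ * cylRadius x ≤ C₀ * ‖gradient (swirl (u t)) x‖) :
    IsFlatSwirlGaugeOn ν u T x₀ ρ C₀ M (fun t => swirl (u t))
      (fun _ x => (-(2 / cylRadius x)) • eR x) (fun _ => cylRadius) := by
  have hI : Ioo (T - ρ ^ 2) T ⊆ Ioo 0 T := Ioo_subset_Ioo_left (by linarith)
  refine ⟨hρ, hρT, ?_, fun t _ δ hδ => ?_, fun t ht x hx => ?_⟩
  · exact h.smooth_velocity.contDiffOn_uncurry_swirl.mono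
      (prod_mono (hI.trans Ioo_subset_Ico_self) (subset_univ _))
  · refine (volume_cylRadius_lt_inter_ball_le x₀ ρ hδ.1.le).trans (ENNReal.ofReal_le_ofReal ?_)
    have : 0 ≤ δ ^ 2 * ρ := by positivity
    nlinarith
  · refine ⟨hM t ht x hx, (hu t (Ioo_subset_Ico_self (hI ht))).inner_curl_gradient_swirl x,
      fun hr => ⟨hω t ht x hx, ?_, h.deriv_swirl_transport hu hp (hI ht) hr.ne'⟩⟩
    show ‖(-(2 / cylRadius x)) • eR x‖ * cylRadius x ≤ C₀
    rw [norm_smul, norm_neg, norm_div, Real.norm_eq_abs, Real.norm_eq_abs, abs_of_pos hr,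
      norm_eR_eq_one_of_ne hr.ne', abs_two]
    calc 2 / cylRadius x * 1 * cylRadius x = 2 := by field_simp
      _ ≤ C₀ := by linarith

/-- **Axisymmetric flows have flat swirl gauges wherever `Γ` and `‖ω‖ r / ‖∇Γ‖` are bounded**
(corollary of `IsClassicalNSSolutionOn.isFlatSwirlGaugeOn_swirl` with the constant `max C 8`). [cite: KNSS2009, eq. (1.8)] -/
theorem IsClassicalNSSolutionOn.hasFlatSwirlGauge_of_axisymmetric {ν T : ℝ} {u : ℝ → ℝ³ → ℝ³}
    {p : ℝ → ℝ³ → ℝ} (h : IsClassicalNSSolutionOn (Ico 0 T) ν 0 u p)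
    (hu : ∀ t ∈ Ico 0 T, IsAxisymmetric (u t)) (hp : ∀ t ∈ Ico 0 T, IsAxisymmetricScalar (p t))
    {x₀ : ℝ³} {ρ C M : ℝ} (hρ : 0 < ρ) (hρT : ρ ^ 2 < T)
    (hM : ∀ t ∈ Ioo (T - ρ ^ 2) T, ∀ x ∈ ball x₀ ρ, |swirl (u t) x| ≤ M)
    (hω : ∀ t ∈ Ioo (T - ρ ^ 2) T, ∀ x ∈ ball x₀ ρ,
      ‖curl (u t) x‖ * cylRadius x ≤ C * ‖gradient (swirl (u t)) x‖) :
    HasFlatSwirlGauge ν u T x₀ :=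
  (h.isFlatSwirlGaugeOn_swirl hu hp hρ hρT (le_max_right C 8) hM fun t ht x hx =>
    (hω t ht x hx).trans (mul_le_mul_of_nonneg_right (le_max_left C 8) (norm_nonneg _))).hasFlatSwirlGauge

end Literature.Analysis.FluidPDE
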